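import Literature.Probability.Percolation.CentralFiveArmCert
import Literature.Probability.Percolation.FiveArmEvent
import HarnessLib

/-!
# The central five-arm site, IV: the event and its probability, by decoupling along the explored set

Topic `Literature/Probability/Percolation`; family `crit-perc`. PROOFS ONLY (no definition of a
named fact). Fourth brick of the separation-free proof of the near-critical a priori lower bound
of the ALTERNATING four-arm probability `π̂^alt_t(m, n) ≥ c (m/n)^{2-β}` below `L(t)`
(W. Werner, PCMI 2009, Lecture 6, §3; P. Nolin, EJP 13 (2008), Thm. 24 (ii), Thm. 27
[arXiv 0711.4948: Thm. 23 (ii), Thm. 26]) — the hypothesis `hLB` of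
`Nolin2008_thm27_oneArm_of_altHyps` and of `Werner2009_oneArm_logDeriv_of_altSeparation`.

`real_centralSite_ge` — at every density `s` and every scale `u ≥ 3`, in the arena
`[-24u, 40u] × [0, 64u]` around the parallelogram `R(16u, 64u)`, the event "there is an explored
site `v` of the lowest open crossing of `R` around every `r`-neighbour `z` of which `ω - z` lies
in `altFourArm (r+1) R □ armEvent ![open] (r+1) R` for all `r + 1 < R ≤ 20u - r`" (the conclusion
of `exists_forall_relabel_shift_mem_alt_disjointOccurrence`, `CentralFiveArmCert.lean`) has
probability at least `q ^ 12` as soon as `q` bounds from below the `P_s`- and the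
`P_{1-s}`-probability of crossing the long way every parallelogram `[0, w] × [0, h]` with
`u ≤ h ≤ 4u` and `w ≤ 64 h`. The twelve crossings: an open crossing of the rows
`[25u+1, 29u+1]` (whence the lowest open crossing `κ` and the height bound `29u+1` of the explored
set, `explored_row_le`), a closed crossing of the rows `[24u, 25u]` hung from the bottom side by a
closed vertical crossing of `[7u, 9u] × [0, 25u]` (the FLOOR: every open left–right-connected set
of `R` then lies in the rows `≥ 24u`, `floor_rows_ge`) — these are the explored data (Harris,
independence) — and, conditionally on the explored data, by the stopping-set decoupling
`mul_real_mem_dataEvent_le` (`StoppingSetDecoupling.lean`; Nolin: "the percolation in the region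
above it remains unbiased"): three vertical crossings of the columns `[3u, 4u]` (closed),
`[7u, 9u]` (open), `[12u, 13u]` (closed) off the explored set, two closed SEALS crossing
`[0, 4u] × [33u+3, 35u+3]` and `[12u, 16u] × [33u+3, 35u+3]`, two open horizontal TRUNKS crossing
`[-24u, 2u] × [29u+2, 33u+2]` and `[14u, 40u] × [29u+2, 33u+2]`, and two open vertical paths of
`[0, 2u] × [24u-1, 33u+2]`, `[14u, 16u] × [24u-1, 33u+2]` off the explored set down to a
neighbour of it (each implied by the full vertical crossing, which meets `κ`). The four closed
conditional events are determined by sites disjoint from those of the five open ones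
(independence), and within each colour class Harris' inequality applies.

## References

* P. Nolin, Near-critical percolation in two dimensions, *Electron. J. Probab.* 13 (2008)
  1562–1623, §5.2, proof of Thm. 24 (ii) (arXiv 0711.4948: Thm. 23 (ii), p. 17) [Nolin2008].
* W. Werner, *Lectures on two-dimensional critical percolation*, IAS/Park City Math. Ser. 16
  (2009), Lecture 6, §3; first exercise sheet, "Five-arm exponent", 3 [WernerPCMI2009].
* H. Kesten, Scaling relations for 2D-percolation, *Comm. Math. Phys.* 109 (1987), proof of
  Lemma 2 (conditioning on the lowest crossing) [KestenScalingCMP1987].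
* B. Bollobás, O. Riordan, *Percolation*, CUP (2006), Ch. 7, p. 175 (stopping sets)
  [BollobasRiordan2006].

## Mathlib / tree

Tree: `exists_forall_relabel_shift_mem_alt_disjointOccurrence` (`CentralFiveArmCert.lean`),
`explored_row_le` (`FiveArmEvent.lean`), `band_meet`, `column_meet` (`CentralFiveArmIndex.lean`),
`mul_real_mem_dataEvent_le` (`StoppingSetDecoupling.lean`), `isStoppingSet_explored`,
`exists_lr_subset_explored`, `explored_subset`, `mem_explored`, `mem_botCluster`,
`bottomSide_subset_explored`, `botCluster_subset_explored` (`TriLowestCrossingSwitch.lean`),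
`triHCross`, `triVCross`, `triStrip(Finset)`, `determinedBy_triHCross/triVCross`,
`isUpperSet_triHCross/triVCross`, `triSitePercolation_real_triHCross/triVCross`,
`determinedBy_compl_mem`, `pathIn_inter_congr` (`TriRSWChaining.lean`), `sitePercolation_harris'`,
`sitePercolation_real_inter_of_disjoint` (`SitePercolationMeasure.lean`),
`sitePercolation_real_preimage_compl` (`TriHexLemma.lean`), `DeterminedBy.mono/inter`,
`determinedBy_univ` (`PercolationEvents.lean`).
-/

noncomputable section

open Set MeasureTheory
open scoped unitInterval

namespace Literature.Probability.Percolation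

open LatticeModels

variable {M N : ℕ} {ω : Set (Site 2)}

/-! ### The floor -/

/-- **The floor lemma.** Let `ξ` be a left–right crossing of `R(M, N)` inside the rows
`[B₀, B₁]` and `ζ` a bottom–top crossing of `[a₀, a₁] × [0, B₁]` (`0 ≤ a₀ ≤ a₁ ≤ M`), both inside a
set `C` of sites. Then every left–right-connected set `S ⊆ R` disjoint from `C` lies in the rows
`≥ B₀`: its left–right path is not inside the rows `≤ B₁` (it would meet `ζ`, `column_meet`), and a
site of `S` below the row `B₀` would be joined inside `S` to a site above the row `B₁` by a path
traversing the band of `ξ` (`band_meet`). [cite: KestenPTM1982, §2.2–2.3 (paths crossing a rectangle must intersect)] -/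
theorem floor_rows_ge {C S : Set (Site 2)} {B₀ B₁ a₀ a₁ : ℤ} (hB : B₀ ≤ B₁) (ha : a₀ ≤ a₁)
    (ha₀ : 0 ≤ a₀) (ha₁ : a₁ ≤ M)
    (hξ : ∃ x y : Site 2, x 0 = 0 ∧ y 0 = M ∧
      PathIn triGraph ({z : Site 2 | (0 : ℤ) ≤ z 0 ∧ z 0 ≤ M ∧ B₀ ≤ z 1 ∧ z 1 ≤ B₁} ∩ C) x y)
    (hζ : ∃ x y : Site 2, x 1 = 0 ∧ y 1 = B₁ ∧
      PathIn triGraph ({z : Site 2 | a₀ ≤ z 0 ∧ z 0 ≤ a₁ ∧ (0 : ℤ) ≤ z 1 ∧ z 1 ≤ B₁} ∩ C) x y)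
    (hSC : Disjoint S C) (hSR : S ⊆ (↑(rectangle M N) : Set (Site 2))) {x y : Site 2}
    (hx : x 0 = 0) (hy : y 0 = M) (hP : PathIn triGraph S x y) (hconn : ∀ z ∈ S, PathIn triGraph S x z) :
    ∀ z ∈ S, B₀ ≤ z 1 := by
  obtain ⟨xξ, yξ, hxξ, hyξ, hpξ⟩ := hξ
  obtain ⟨xζ, yζ, hxζ, hyζ, hpζ⟩ := hζ
  have hSco : ∀ z ∈ S, (0 : ℤ) ≤ z 0 ∧ z 0 ≤ M ∧ (0 : ℤ) ≤ z 1 ∧ z 1 ≤ N := fun z hz =>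
    mem_coe_rectangle.1 (hSR hz)
  -- some site of `S` lies above the row `B₁`
  obtain ⟨w, hwS, hwB⟩ : ∃ w ∈ S, B₁ < w 1 := by
    by_contra hno
    push Not at hno
    obtain ⟨z, hzS, hzζ⟩ := column_meet (B := 0) (T := B₁) ha (Aζ := _ ∩ C) (A := S)
      (fun z hz => ⟨hz.1.1, hz.1.2.1, hz.1.2.2.1, hz.1.2.2.2⟩) hpζ hxζ hyζ
      (fun z hz => ⟨(hSco z hz).2.2.1, hno z hz⟩) hP (by rw [hx]; exact ha₀) (by rw [hy]; exact ha₁)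
    exact Set.disjoint_left.1 hSC hzS hzζ.2
  intro z hzS
  by_contra hlt
  rw [not_le] at hlt
  have hzw : PathIn triGraph S z w := (hconn z hzS).symm.trans (hconn w hwS)
  obtain ⟨s, hsS, hsξ⟩ := band_meet (L := 0) (R := (M : ℤ)) hB (Aξ := _ ∩ C) (A := S)
    (fun z hz => ⟨hz.1.1, hz.1.2.1, hz.1.2.2.1, hz.1.2.2.2⟩) hpξ hxξ hyξ
    (fun z hz => ⟨(hSco z hz).1, (hSco z hz).2.1⟩) hzw (le_of_lt hlt) (le_of_lt hwB)
  exact Set.disjoint_left.1 hSC hsS hsξ.2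

/-- **The floor hangs from the bottom side inside the explored set.** A closed left–right crossing
of the rows `[B₀, B₀ + h]` of `R(M, N)` and a closed bottom–top crossing of `[a₀, a₀ + w] × [0, B₀ + h]`
(`a₀ + w ≤ M`, `B₀ + h ≤ N`) meet, so both lie in the closed cluster of the bottom side, i.e. in the
closed explored sites. [cite: KestenPTM1982, §2.2–2.3] -/
theorem floor_subset_explored {B₀ a₀ : ℤ} {h w k : ℕ} (hB₀ : 0 ≤ B₀) (hBN : B₀ + h ≤ N) (ha₀ : 0 ≤ a₀)
    (haM : a₀ + w ≤ M) (hk : (k : ℤ) = B₀ + h) (hH : ωᶜ ∈ triHCross 0 B₀ M h) (hV : ωᶜ ∈ triVCross a₀ 0 w k) :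
    (∃ x y : Site 2, x 0 = 0 ∧ y 0 = M ∧
      PathIn triGraph ({z : Site 2 | (0 : ℤ) ≤ z 0 ∧ z 0 ≤ M ∧ B₀ ≤ z 1 ∧ z 1 ≤ B₀ + h} ∩
        (↑(explored M N ω) \ ω)) x y) ∧
    (∃ x y : Site 2, x 1 = 0 ∧ y 1 = B₀ + h ∧
      PathIn triGraph ({z : Site 2 | a₀ ≤ z 0 ∧ z 0 ≤ a₀ + w ∧ (0 : ℤ) ≤ z 1 ∧ z 1 ≤ B₀ + h} ∩
        (↑(explored M N ω) \ ω)) x y) := by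
  obtain ⟨x, y, hx, hy, hξ⟩ := hH
  obtain ⟨b, d, hb, hd, hζ⟩ := hV
  rw [hk, zero_add] at hd
  rw [zero_add] at hy
  have hstripR : ∀ z, z ∈ triStrip 0 B₀ M h ∨ z ∈ triStrip a₀ 0 w k →
      z ∈ (↑(rectangle M N) : Set (Site 2)) := by
    rintro z (hz | hz) <;> rw [mem_triStrip] at hz <;>
      exact Finset.mem_coe.2 (mem_rectangle_iff.2 ⟨by omega, by omega, by omega, by omega⟩)
  -- the two crossings meet (inside the clusters of their starting sites)
  set Clζ : Set (Site 2) := {z | PathIn triGraph (triStrip a₀ 0 w k ∩ ωᶜ) b z} with hClζ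
  set Clξ : Set (Site 2) := {z | PathIn triGraph (triStrip 0 B₀ M h ∩ ωᶜ) x z} with hClξ
  obtain ⟨m, hmξ, hmζ⟩ := column_meet (B := 0) (T := B₀ + h) (a₀ := a₀) (a₁ := a₀ + w) (by omega)
    (Aζ := Clζ) (A := Clξ) (fun z hz => by have := mem_triStrip.1 hz.right_mem.1; omega) hζ.pathIn_cluster
    hb hd (fun z hz => by have := mem_triStrip.1 hz.right_mem.1; omega) hξ.pathIn_cluster
    (by rw [hx]; exact ha₀) (by rw [hy]; exact haM)
  -- `b` is on the bottom side: everything is in the closed cluster of the bottom side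
  have hbB : b ∈ bottomSide M N := by
    have hb' := mem_triStrip.1 hζ.left_mem.1
    exact Finset.mem_filter.2 ⟨mem_rectangle_iff.2 ⟨by omega, by omega, by omega, by omega⟩, hb⟩
  have hRζ : triStrip a₀ 0 w k ∩ ωᶜ ⊆ ↑(rectangle M N) ∩ ωᶜ := fun z hz =>
    ⟨hstripR z (Or.inr hz.1), hz.2⟩
  have hRξ : triStrip 0 B₀ M h ∩ ωᶜ ⊆ ↑(rectangle M N) ∩ ωᶜ := fun z hz => ⟨hstripR z (Or.inl hz.1), hz.2⟩
  have hbot : ∀ z, PathIn triGraph (↑(rectangle M N) ∩ ωᶜ) b z → z ∈ (↑(explored M N ω) : Set (Site 2)) \ ω :=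
    fun z hz => ⟨botCluster_subset_explored (mem_botCluster.2 ⟨b, hbB, hz⟩), hz.right_mem.2⟩
  have hbm : PathIn triGraph (↑(rectangle M N) ∩ ωᶜ) b m := hmζ.mono hRζ
  have hbx : PathIn triGraph (↑(rectangle M N) ∩ ωᶜ) b x := hbm.trans (hmξ.mono hRξ).symm
  have hClξE : Clξ ⊆ {z : Site 2 | (0 : ℤ) ≤ z 0 ∧ z 0 ≤ M ∧ B₀ ≤ z 1 ∧ z 1 ≤ B₀ + h} ∩
      (↑(explored M N ω) \ ω) := fun z hz =>
    ⟨by have := mem_triStrip.1 hz.right_mem.1; exact ⟨this.1, by omega, this.2.2.1, this.2.2.2⟩,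
      hbot z (hbx.trans (hz.mono hRξ))⟩
  have hClζE : Clζ ⊆ {z : Site 2 | a₀ ≤ z 0 ∧ z 0 ≤ a₀ + w ∧ (0 : ℤ) ≤ z 1 ∧ z 1 ≤ B₀ + h} ∩
      (↑(explored M N ω) \ ω) := fun z hz =>
    ⟨by have := mem_triStrip.1 hz.right_mem.1; exact ⟨this.1, this.2.1, this.2.2.1, by omega⟩,
      hbot z (hz.mono hRζ)⟩
  exact ⟨⟨x, y, hx, hy, hξ.pathIn_cluster.mono hClξE⟩, ⟨b, d, hb, hd, hζ.pathIn_cluster.mono hClζE⟩⟩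


/-! ### The vertical trunk pieces off the explored set -/

/-- **A vertical crossing of a side box meets the lowest crossing, hence lands next to the
explored set.** Let `F` (the explored set) contain a left–right path of `R(M, N)` all of whose
sites have rows in `[B_V, Y_V]`, and have all its sites in the rows `< Y_V`. Then every
configuration with an open bottom–top crossing of `[a, a + w] × [B_V, Y_V]` (`0 ≤ a`, `a + w ≤ M`)
has an open path of that box off `F` from its top row to a neighbour of `F`: the crossing meets the
left–right path (`PathIn.tri_crossings_meet`, after extracting the latter's passage through the
columns `[a, a + w]`), and one follows it from the top down to its first site in `F`. [cite: KestenPTM1982, §2.2 (paths crossing a rectangle must intersect)] -/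
theorem exists_vbox_path_of_vcross {F : Finset (Site 2)} {a BV : ℤ} {w hV : ℕ} {YV : ℤ}
    (hYV : BV + hV = YV) (ha : 0 ≤ a) (haM : a + w ≤ M)
    (hrow : ∀ e ∈ F, e 1 < YV)
    (hκ : ∃ (S : Set (Site 2)) (x y : Site 2), S ⊆ ↑F ∧ x 0 = 0 ∧ y 0 = M ∧ PathIn triGraph S x y ∧
      ∀ z ∈ S, BV ≤ z 1 ∧ z 1 ≤ YV)
    {η : Set (Site 2)} (hη : η ∈ triVCross a BV w hV) :
    ∃ tV g e : Site 2, tV 1 = BV + hV ∧ e ∈ F ∧ triGraph.Adj g e ∧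
      PathIn triGraph ((triStrip a BV w hV \ ↑F) ∩ η) tV g := by
  obtain ⟨S, x, y, hSF, hx, hy, hP, hSrow⟩ := hκ
  obtain ⟨tb, tt, htb, htt, hQ⟩ := hη
  -- the passage of the left–right path through the columns `[a, a + w]`
  obtain ⟨x', y', hx', hy', hP'⟩ := hP.exists_slab_crossing 0 (show a ≤ a + w by omega)
    (by rw [hx]; exact ha) (by rw [hy]; exact haM)
  -- the support of the vertical crossing
  obtain ⟨T, hTsub, hQ', hTconn⟩ := hQ.exists_support
  obtain ⟨m, hmP, hmT⟩ := PathIn.tri_crossings_meet (L := a) (R := a + w) (B := BV) (T := BV + hV)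
    (A := S ∩ {z | a ≤ z 0 ∧ z 0 ≤ a + w}) (A' := T)
    (fun z hz => ⟨hz.2.1, hz.2.2, (hSrow z hz.1).1, by rw [hYV]; exact (hSrow z hz.1).2⟩)
    (fun z hz => by have := mem_triStrip.1 (hTsub hz).1; omega) hP' hx' hy' hQ' htb htt
  -- follow the crossing from the top down to its first site of `F`
  have hmF : m ∈ (↑F : Set (Site 2)) := hSF hmP.1
  have httF : tt ∉ (↑F : Set (Site 2)) := fun h => by
    have := hrow tt h; rw [htt] at this; omega
  have hpath : PathIn triGraph T tt m := (hTconn tt hQ'.right_mem).symm.trans (hTconn m hmT)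
  obtain ⟨g, e, hg, he, -, hge, hq⟩ := hpath.exit (R := (↑F : Set (Site 2))ᶜ) httF (fun h => h hmF)
  refine ⟨tt, g, e, htt, not_not.1 he, hge, hq.mono fun z hz => ⟨⟨(hTsub hz.2).1, hz.1⟩, (hTsub hz.2).2⟩⟩

/-! ### The probability of the central five-arm configuration -/

set_option maxHeartbeats 4000000 in
/-- **The central five-arm configuration has probability at least `q¹²`.** See the module
docstring. [cite: Nolin2008, §5.2, proof of Thm. 24 (ii) (arXiv 0711.4948: Thm. 23 (ii), p. 17)] [cite: WernerPCMI2009, Lecture 6, §3; first exercise sheet, "Five-arm exponent", 3] [cite: KestenScalingCMP1987, proof of Lemma 2 (conditioning on the lowest crossing)] -/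
theorem real_centralSite_ge (s : unitInterval) {u M N : ℕ} (hu : 3 ≤ u) (hM : M = 16 * u) (hN : N = 64 * u)
    {q : ℝ} (hq0 : 0 ≤ q)
    (hq : ∀ w h : ℕ, u ≤ h → h ≤ 4 * u → w ≤ 64 * h →
      q ≤ triLRCrossingProb s w h ∧ q ≤ triLRCrossingProb (σ s) w h) :
    q ^ 12 ≤ (triSitePercolation s).real {ω | ∃ v ∈ explored M N ω, ∀ (z : Site 2) (r R : ℕ),
        triNorm (v - z) ≤ r → r + 1 < R → R + r ≤ 20 * u →
          SiteConfig.relabel (triShiftIso (-z)).toEquiv ω ∈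
            altFourArm (r + 1) R □ armEvent ![true] (r + 1) R} := by
  classical
  /- geometry: every quantity gets a name, used consistently below -/
  obtain ⟨D, hD⟩ : ∃ D : ℕ, D = 20 * u := ⟨_, rfl⟩
  rw [← hD]
  obtain ⟨WW, hWW⟩ : ∃ WW : ℕ, WW = 24 * u := ⟨_, rfl⟩
  obtain ⟨wS, hwS⟩ : ∃ wS : ℕ, wS = 2 * u := ⟨_, rfl⟩
  obtain ⟨hT4, hhT4⟩ : ∃ hT4 : ℕ, hT4 = 4 * u := ⟨_, rfl⟩
  obtain ⟨hV9, hhV9⟩ : ∃ hV9 : ℕ, hV9 = 9 * u + 3 := ⟨_, rfl⟩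
  obtain ⟨bS4, hbS4⟩ : ∃ bS4 : ℕ, bS4 = 4 * u := ⟨_, rfl⟩
  obtain ⟨Hh, hHh⟩ : ∃ Hh : ℕ, Hh = 29 * u + 1 := ⟨_, rfl⟩
  obtain ⟨BV, hBVdef⟩ : ∃ BV : ℤ, BV = 24 * u - 1 := ⟨_, rfl⟩
  obtain ⟨B0, hB0⟩ : ∃ B0 : ℤ, B0 = 24 * u := ⟨_, rfl⟩
  obtain ⟨a1, ha1⟩ : ∃ a1 : ℤ, a1 = 7 * u := ⟨_, rfl⟩
  obtain ⟨a2, ha2⟩ : ∃ a2 : ℤ, a2 = 3 * u := ⟨_, rfl⟩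
  obtain ⟨a3, ha3⟩ : ∃ a3 : ℤ, a3 = 12 * u := ⟨_, rfl⟩
  obtain ⟨aS, haS⟩ : ∃ aS : ℤ, aS = 12 * u := ⟨_, rfl⟩
  have hM' : (M : ℤ) = 16 * u := by rw [hM]; push_cast; ring
  have hN' : (N : ℤ) = 64 * u := by rw [hN]; push_cast; ring
  have hMaS : ((M : ℤ) - aS).toNat = 4 * u := by omega
  /- the data-indexed events -/
  set floorOK : Set (Site 2) → Prop := fun C =>
    (∃ x y : Site 2, x 0 = 0 ∧ y 0 = M ∧
      PathIn triGraph ({z : Site 2 | (0 : ℤ) ≤ z 0 ∧ z 0 ≤ M ∧ B0 ≤ z 1 ∧ z 1 ≤ B0 + u} ∩ C) x y) ∧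
    (∃ x y : Site 2, x 1 = 0 ∧ y 1 = B0 + u ∧
      PathIn triGraph ({z : Site 2 | a1 ≤ z 0 ∧ z 0 ≤ a1 + wS ∧ (0 : ℤ) ≤ z 1 ∧ z 1 ≤ B0 + u} ∩ C) x y)
    with hfloorOK
  set good : Finset (Site 2) → Finset (Site 2) → Prop := fun F η =>
    bottomSide M N ⊆ F ∧ (∀ e ∈ F, e 1 ≤ Hh) ∧ LRPathIn M N (↑F ∩ ↑η) ∧ floorOK (↑F \ ↑η)
    with hgood
  set Col₁ : Set (Site 2) := triStrip a1 0 wS N with hCol₁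
  set Col₂ : Set (Site 2) := triStrip a2 0 u N with hCol₂
  set Col₃ : Set (Site 2) := triStrip a3 0 u N with hCol₃
  set VBL : Set (Site 2) := triStrip 0 BV wS hV9 with hVBL
  set VBR : Set (Site 2) := triStrip ((M : ℤ) - wS) BV wS hV9 with hVBR
  set Ucol : Set (Site 2) → Finset (Site 2) → Set (Set (Site 2)) := fun Col F =>
    {η | ∃ t ∈ topSide M N, ∃ g e : Site 2, e ∈ F ∧ triGraph.Adj g e ∧ PathIn triGraph ((Col \ ↑F) ∩ η) t g}
    with hUcol
  set Uv : Set (Site 2) → Finset (Site 2) → Set (Set (Site 2)) := fun VB F =>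
    {η | ∃ tV g e : Site 2, tV 1 = BV + hV9 ∧ e ∈ F ∧ triGraph.Adj g e ∧ PathIn triGraph ((VB \ ↑F) ∩ η) tV g}
    with hUv
  set USL : Set (Set (Site 2)) := triHCross 0 ((Hh : ℤ) + hT4 + 2) bS4 wS with hUSL
  set USR : Set (Set (Site 2)) := triHCross aS ((Hh : ℤ) + hT4 + 2) ((M : ℤ) - aS).toNat wS with hUSR
  set UHL : Set (Set (Site 2)) := triHCross (-(WW : ℤ)) ((Hh : ℤ) + 1) (WW + wS) hT4 with hUHL
  set UHR : Set (Set (Site 2)) := triHCross ((M : ℤ) - wS) ((Hh : ℤ) + 1) (wS + WW) hT4 with hUHR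
  set CG : Finset (Site 2) → Set (Set (Site 2)) := fun F => Ucol Col₂ F ∩ Ucol Col₃ F ∩ USL ∩ USR with hCG
  set OG : Finset (Site 2) → Set (Set (Site 2)) := fun F => Ucol Col₁ F ∩ UHL ∩ Uv VBL F ∩ UHR ∩ Uv VBR F
    with hOG
  set Aev : Finset (Site 2) → Finset (Site 2) → Set (Set (Site 2)) := fun F η =>
    if good F η then univ else ∅ with hAev
  set Bev : Finset (Site 2) → Finset (Site 2) → Set (Set (Site 2)) := fun F η =>
    if good F η then {ω | ωᶜ ∈ CG F} ∩ OG F else ∅ with hBev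
  set μ := sitePercolation (Site 2) s with hμ
  set μ' := sitePercolation (Site 2) (σ s) with hμ'
  have hμt : triSitePercolation s = μ := rfl
  have hμt' : triSitePercolation (σ s) = μ' := rfl
  -- finsets of the supports
  set Col₁f := triStripFinset a1 0 wS N with hCol₁f
  set Col₂f := triStripFinset a2 0 u N with hCol₂f
  set Col₃f := triStripFinset a3 0 u N with hCol₃f
  set VBLf := triStripFinset 0 BV wS hV9 with hVBLf
  set VBRf := triStripFinset ((M : ℤ) - wS) BV wS hV9 with hVBRf
  set SLf := triStripFinset 0 ((Hh : ℤ) + hT4 + 2) bS4 wS with hSLf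
  set SRf := triStripFinset aS ((Hh : ℤ) + hT4 + 2) ((M : ℤ) - aS).toNat wS with hSRf
  set HLf := triStripFinset (-(WW : ℤ)) ((Hh : ℤ) + 1) (WW + wS) hT4 with hHLf
  set HRf := triStripFinset ((M : ℤ) - wS) ((Hh : ℤ) + 1) (wS + WW) hT4 with hHRf
  have hcoe : ∀ (a b : ℤ) (m n : ℕ), triStrip a b m n = ↑(triStripFinset a b m n) := fun a b m n =>
    (coe_triStripFinset a b m n).symm
  /- determination and monotonicity of the conditional events -/
  have hdetU : ∀ (Col : Set (Site 2)) (F : Finset (Site 2)), DeterminedBy (Ucol Col F) (Col \ ↑F) := by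
    intro Col F
    rw [determinedBy_iff]
    intro ω ω' hω
    constructor
    · rintro ⟨t, ht, g, e, he, hge, hp⟩; exact ⟨t, ht, g, e, he, hge, pathIn_inter_congr hω hp⟩
    · rintro ⟨t, ht, g, e, he, hge, hp⟩; exact ⟨t, ht, g, e, he, hge, pathIn_inter_congr hω.symm hp⟩
  have hdetUv : ∀ (VB : Set (Site 2)) (F : Finset (Site 2)), DeterminedBy (Uv VB F) (VB \ ↑F) := by
    intro VB F
    rw [determinedBy_iff]
    intro ω ω' hω
    constructor
    · rintro ⟨t, g, e, ht, he, hge, hp⟩; exact ⟨t, g, e, ht, he, hge, pathIn_inter_congr hω hp⟩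
    · rintro ⟨t, g, e, ht, he, hge, hp⟩; exact ⟨t, g, e, ht, he, hge, pathIn_inter_congr hω.symm hp⟩
  have hupU : ∀ (Col : Set (Site 2)) (F : Finset (Site 2)), IsUpperSet (Ucol Col F) := by
    rintro Col F η η' hle ⟨t, ht, g, e, he, hge, hp⟩
    exact ⟨t, ht, g, e, he, hge, hp.mono fun z hz => ⟨hz.1, hle hz.2⟩⟩
  have hupUv : ∀ (VB : Set (Site 2)) (F : Finset (Site 2)), IsUpperSet (Uv VB F) := by
    rintro VB F η η' hle ⟨t, g, e, ht, he, hge, hp⟩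
    exact ⟨t, g, e, ht, he, hge, hp.mono fun z hz => ⟨hz.1, hle hz.2⟩⟩
  -- each conditional event is determined by its own support
  have hd₂ : ∀ F, DeterminedBy (Ucol Col₂ F) ↑(Col₂f \ F) := fun F =>
    (hdetU Col₂ F).mono fun z hz => by rw [Finset.coe_sdiff, ← hcoe]; exact hz
  have hd₃ : ∀ F, DeterminedBy (Ucol Col₃ F) ↑(Col₃f \ F) := fun F =>
    (hdetU Col₃ F).mono fun z hz => by rw [Finset.coe_sdiff, ← hcoe]; exact hz
  have hd₁ : ∀ F, DeterminedBy (Ucol Col₁ F) ↑(Col₁f \ F) := fun F =>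
    (hdetU Col₁ F).mono fun z hz => by rw [Finset.coe_sdiff, ← hcoe]; exact hz
  have hdVL : ∀ F, DeterminedBy (Uv VBL F) ↑(VBLf \ F) := fun F =>
    (hdetUv VBL F).mono fun z hz => by rw [Finset.coe_sdiff, ← hcoe]; exact hz
  have hdVR : ∀ F, DeterminedBy (Uv VBR F) ↑(VBRf \ F) := fun F =>
    (hdetUv VBR F).mono fun z hz => by rw [Finset.coe_sdiff, ← hcoe]; exact hz
  have hdSL : DeterminedBy USL ↑SLf := determinedBy_triHCross _ _ _ _
  have hdSR : DeterminedBy USR ↑SRf := determinedBy_triHCross _ _ _ _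
  have hdHL : DeterminedBy UHL ↑HLf := determinedBy_triHCross _ _ _ _
  have hdHR : DeterminedBy UHR ↑HRf := determinedBy_triHCross _ _ _ _
  /- the full crossings imply the conditional events, for good data -/
  have hfullU : ∀ (a : ℤ) (w : ℕ) (F : Finset (Site 2)), 0 ≤ a → a + w ≤ M → bottomSide M N ⊆ F →
      (∀ e ∈ F, e 1 ≤ Hh) → triVCross a 0 w N ⊆ Ucol (triStrip a 0 w N) F := by
    intro a w F ha haM hBF hHF ω ⟨b', t', hb', ht', hp⟩
    have hb'F : b' ∈ (↑F : Set (Site 2)) := by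
      have hb'C := hp.left_mem.1
      rw [mem_triStrip] at hb'C
      exact Finset.mem_coe.2 (hBF (Finset.mem_filter.2
        ⟨mem_rectangle_iff.2 ⟨by omega, by omega, by omega, by omega⟩, hb'⟩))
    have ht'C := hp.right_mem.1
    rw [mem_triStrip] at ht'C
    have ht'N : t' 1 = N := by omega
    have ht'F : t' ∉ (↑F : Set (Site 2)) := fun h' => by
      have := hHF t' (Finset.mem_coe.1 h'); omega
    obtain ⟨g, e, -, heF, -, hge, hq'⟩ := hp.symm.exit (R := (↑F : Set (Site 2))ᶜ) ht'F (fun h' => h' hb'F)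
    refine ⟨t', ?_, g, e, not_not.1 heF, hge, hq'.mono fun z hz => ⟨⟨hz.2.1, hz.1⟩, hz.2.2⟩⟩
    exact Finset.mem_filter.2 ⟨mem_rectangle_iff.2 ⟨by omega, by omega, by omega, by omega⟩, ht'N⟩
  -- the lowest crossing of good data: rows in `[B0, Hh]`
  have hκgood : ∀ F η, good F η → ∃ (S : Set (Site 2)) (x y : Site 2), S ⊆ ↑F ∧ x 0 = 0 ∧ y 0 = M ∧
      PathIn triGraph S x y ∧ ∀ z ∈ S, BV ≤ z 1 ∧ z 1 ≤ BV + hV9 := by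
    rintro F η ⟨-, hHF, ⟨x, y, hx, hy, hp⟩, hξ, hζ⟩
    set S : Set (Site 2) := {z | PathIn triGraph (↑(rectangle M N) ∩ (↑F ∩ ↑η)) x z} with hS
    have hSF : S ⊆ ↑F := fun z hz => hz.right_mem.2.1
    have hrows : ∀ z ∈ S, B0 ≤ z 1 :=
      floor_rows_ge (M := M) (N := N) (C := ↑F \ ↑η) (S := S) (by omega) (by omega) (by omega) (by omega)
        hξ hζ (Set.disjoint_left.2 fun z hz hz' => hz'.2 hz.right_mem.2.2) (fun z hz => hz.right_mem.1)
        hx hy hp.pathIn_cluster (fun z hz => PathIn.pathIn_cluster hz)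
    refine ⟨S, x, y, hSF, hx, hy, hp.pathIn_cluster, fun z hz => ⟨by have := hrows z hz; omega, ?_⟩⟩
    have := hHF z (hSF hz); omega
  have hfullVL : ∀ F η, good F η → triVCross 0 BV wS hV9 ⊆ Uv VBL F := by
    intro F η hg ω hω
    have hHF := hg.2.1
    exact exists_vbox_path_of_vcross (M := M) rfl le_rfl (by omega) (fun e he => by have := hHF e he; omega)
      (hκgood F η hg) hω
  have hfullVR : ∀ F η, good F η → triVCross ((M : ℤ) - wS) BV wS hV9 ⊆ Uv VBR F := by
    intro F η hg ω hω
    have hHF := hg.2.1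
    exact exists_vbox_path_of_vcross (M := M) rfl (by omega) (by omega)
      (fun e he => by have := hHF e he; omega) (hκgood F η hg) hω
  /- crossing probabilities of the twelve pieces -/
  have hqu : ∀ {w h : ℕ}, u ≤ h → h ≤ 4 * u → w ≤ 64 * h → q ≤ triLRCrossingProb s w h :=
    fun h1 h2 h3 => (hq _ _ h1 h2 h3).1
  have hqu' : ∀ {w h : ℕ}, u ≤ h → h ≤ 4 * u → w ≤ 64 * h → q ≤ triLRCrossingProb (σ s) w h :=
    fun h1 h2 h3 => (hq _ _ h1 h2 h3).2
  have hnn : ∀ (p : unitInterval) (A : Set (Set (Site 2))), 0 ≤ (sitePercolation (Site 2) p).real A :=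
    fun p A => measureReal_nonneg
  /- Harris for several increasing events -/
  have harris : ∀ (p : unitInterval) {A B : Set (Set (Site 2))} {FA FB : Finset (Site 2)},
      DeterminedBy A ↑FA → DeterminedBy B ↑FB → IsUpperSet A → IsUpperSet B → ∀ {a b : ℝ}, 0 ≤ a → 0 ≤ b →
      a ≤ (sitePercolation (Site 2) p).real A → b ≤ (sitePercolation (Site 2) p).real B →
      a * b ≤ (sitePercolation (Site 2) p).real (A ∩ B) := by
    intro p A B FA FB hA hB hAu hBu a b ha hb haA hbB
    exact (mul_le_mul haA hbB hb (hnn p A)).trans (sitePercolation_harris' p hA hB hAu hBu)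
  /- the decoupling inequality -/
  -- disjointness of the closed supports from the open ones
  have hdisjCO : Disjoint (Col₂f ∪ Col₃f ∪ SLf ∪ SRf) (Col₁f ∪ VBLf ∪ VBRf ∪ HLf ∪ HRf) := by
    rw [Finset.disjoint_left]
    intro z hz hz'
    simp only [Finset.mem_union] at hz hz'
    have key : ∀ {a b : ℤ} {m n : ℕ}, z ∈ triStripFinset a b m n → a ≤ z 0 ∧ z 0 ≤ a + m ∧ b ≤ z 1 ∧ z 1 ≤ b + n :=
      fun h => mem_triStrip.1 (by rw [hcoe]; exact Finset.mem_coe.2 h)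
    rcases hz with ((hz | hz) | hz) | hz <;> rcases hz' with (((hz' | hz') | hz') | hz') | hz' <;>
      · have h1 := key hz; have h2 := key hz'; push_cast at h1 h2; omega
  have hdec : q ^ 9 * μ.real {ω | ω ∈ Aev (explored M N ω) ((explored M N ω).filter (· ∈ ω))} ≤
      μ.real {ω | ω ∈ Bev (explored M N ω) ((explored M N ω).filter (· ∈ ω))} := by
    refine mul_real_mem_dataEvent_le s (G := rectangle M N) (isStoppingSet_explored M N)
      (fun ω => explored_subset ω) Aev Bev ?_ ?_ ?_
    · intro F η
      refine ⟨∅, Finset.disjoint_empty_right _, ?_⟩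
      simp only [hAev]
      split_ifs
      · exact determinedBy_univ _
      · rw [determinedBy_iff]; intro ω ω' _; simp
    · intro F η
      by_cases hg : good F η
      · -- good data: the supports of the seals and trunks are above the explored set
        have hHF := hg.2.1
        have habove : Disjoint F (SLf ∪ SRf ∪ HLf ∪ HRf) := by
          rw [Finset.disjoint_left]
          intro z hzF hz
          have h0 := hHF z hzF
          simp only [Finset.mem_union] at hz
          have key : ∀ {a b : ℤ} {m n : ℕ}, z ∈ triStripFinset a b m n → b ≤ z 1 :=
            fun h => (mem_triStrip.1 (by rw [hcoe]; exact Finset.mem_coe.2 h)).2.2.1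
          rcases hz with ((hz | hz) | hz) | hz <;> · have := key hz; omega
        refine ⟨(Col₂f ∪ Col₃f ∪ Col₁f ∪ VBLf ∪ VBRf) \ F ∪ (SLf ∪ SRf ∪ HLf ∪ HRf),
          Finset.disjoint_union_right.2 ⟨Finset.disjoint_sdiff, habove⟩, ?_⟩
        simp only [hBev, hg, if_true]
        have sub : ∀ {X : Finset (Site 2)}, X ⊆ Col₂f ∪ Col₃f ∪ Col₁f ∪ VBLf ∪ VBRf →
            (↑(X \ F) : Set (Site 2)) ⊆ ↑((Col₂f ∪ Col₃f ∪ Col₁f ∪ VBLf ∪ VBRf) \ F ∪ (SLf ∪ SRf ∪ HLf ∪ HRf)) :=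
          fun hX => Finset.coe_subset.2 ((Finset.sdiff_subset_sdiff hX (subset_refl F)).trans Finset.subset_union_left)
        have sub' : ∀ {X : Finset (Site 2)}, X ⊆ SLf ∪ SRf ∪ HLf ∪ HRf →
            (↑X : Set (Site 2)) ⊆ ↑((Col₂f ∪ Col₃f ∪ Col₁f ∪ VBLf ∪ VBRf) \ F ∪ (SLf ∪ SRf ∪ HLf ∪ HRf)) :=
          fun hX => Finset.coe_subset.2 (hX.trans Finset.subset_union_right)
        refine (determinedBy_compl_mem ((((hd₂ F).mono (sub ?_)).inter ((hd₃ F).mono (sub ?_))).inter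
          (hdSL.mono (sub' ?_)) |>.inter (hdSR.mono (sub' ?_)))).inter
          ((((((hd₁ F).mono (sub ?_)).inter (hdHL.mono (sub' ?_))).inter ((hdVL F).mono (sub ?_))).inter
            (hdHR.mono (sub' ?_))).inter ((hdVR F).mono (sub ?_)))
        · exact (Finset.subset_union_left.trans Finset.subset_union_left).trans
            (Finset.subset_union_left.trans Finset.subset_union_left)
        · exact (Finset.subset_union_right.trans Finset.subset_union_left).trans
            (Finset.subset_union_left.trans Finset.subset_union_left)
        · exact (Finset.subset_union_left.trans Finset.subset_union_left).trans Finset.subset_union_left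
        · exact (Finset.subset_union_right.trans Finset.subset_union_left).trans Finset.subset_union_left
        · exact Finset.subset_union_right.trans (Finset.subset_union_left.trans Finset.subset_union_left)
        · exact Finset.subset_union_right.trans Finset.subset_union_left
        · exact Finset.subset_union_right.trans Finset.subset_union_left
        · exact Finset.subset_union_right
        · exact Finset.subset_union_right
      · refine ⟨∅, Finset.disjoint_empty_right _, ?_⟩
        simp only [hBev, hg, if_false]
        rw [determinedBy_iff]; intro ω ω' _; simp
    · intro F η
      simp only [hAev, hBev]
      split_ifs with hg
      · have hBF := hg.1
        have hHF := hg.2.1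
        rw [probReal_univ, mul_one]
        -- independence of the closed and the open group
        have hdetCG : DeterminedBy {ω : Set (Site 2) | ωᶜ ∈ CG F} ↑((Col₂f ∪ Col₃f) \ F ∪ (SLf ∪ SRf)) := by
          refine determinedBy_compl_mem ((((hd₂ F).mono ?_).inter ((hd₃ F).mono ?_)).inter (hdSL.mono ?_) |>.inter
            (hdSR.mono ?_))
          · exact Finset.coe_subset.2 ((Finset.sdiff_subset_sdiff Finset.subset_union_left (subset_refl F)).trans
              Finset.subset_union_left)
          · exact Finset.coe_subset.2 ((Finset.sdiff_subset_sdiff Finset.subset_union_right (subset_refl F)).trans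
              Finset.subset_union_left)
          · exact Finset.coe_subset.2 (Finset.subset_union_left.trans Finset.subset_union_right)
          · exact Finset.coe_subset.2 (Finset.subset_union_right.trans Finset.subset_union_right)
        have hdetOG : DeterminedBy (OG F) ↑((Col₁f ∪ VBLf ∪ VBRf) \ F ∪ (HLf ∪ HRf)) := by
          refine (((((hd₁ F).mono ?_).inter (hdHL.mono ?_)).inter ((hdVL F).mono ?_)).inter (hdHR.mono ?_)).inter
            ((hdVR F).mono ?_)
          · exact Finset.coe_subset.2 ((Finset.sdiff_subset_sdiff
              (Finset.subset_union_left.trans Finset.subset_union_left) (subset_refl F)).trans Finset.subset_union_left)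
          · exact Finset.coe_subset.2 (Finset.subset_union_left.trans Finset.subset_union_right)
          · exact Finset.coe_subset.2 ((Finset.sdiff_subset_sdiff
              (Finset.subset_union_right.trans Finset.subset_union_left) (subset_refl F)).trans Finset.subset_union_left)
          · exact Finset.coe_subset.2 (Finset.subset_union_right.trans Finset.subset_union_right)
          · exact Finset.coe_subset.2 ((Finset.sdiff_subset_sdiff Finset.subset_union_right (subset_refl F)).trans
              Finset.subset_union_left)
        have hdisj : Disjoint ((Col₂f ∪ Col₃f) \ F ∪ (SLf ∪ SRf)) ((Col₁f ∪ VBLf ∪ VBRf) \ F ∪ (HLf ∪ HRf)) := by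
          refine Finset.disjoint_of_subset_left ?_ (Finset.disjoint_of_subset_right ?_ hdisjCO)
          · intro z hz
            rcases Finset.mem_union.1 hz with h | h
            · exact Finset.mem_union_left _ (Finset.mem_union_left _ (Finset.mem_sdiff.1 h).1)
            · rcases Finset.mem_union.1 h with h | h
              · exact Finset.mem_union_left _ (Finset.mem_union_right _ h)
              · exact Finset.mem_union_right _ h
          · intro z hz
            rcases Finset.mem_union.1 hz with h | h
            · exact Finset.mem_union_left _ (Finset.mem_union_left _ (Finset.mem_sdiff.1 h).1)
            · rcases Finset.mem_union.1 h with h | h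
              · exact Finset.mem_union_left _ (Finset.mem_union_right _ h)
              · exact Finset.mem_union_right _ h
        rw [sitePercolation_real_inter_of_disjoint s hdetCG hdetOG hdisj]
        -- the closed group, priced at `1 - s`
        have hCG4 : q ^ 4 ≤ μ.real {ω : Set (Site 2) | ωᶜ ∈ CG F} := by
          have e : μ.real {ω : Set (Site 2) | ωᶜ ∈ CG F} = μ'.real (CG F) := by
            rw [hμ, hμ', ← sitePercolation_real_preimage_compl]; rfl
          rw [e]
          have h2 : q ≤ μ'.real (Ucol Col₂ F) := by
            refine (hqu' (w := N) (h := u) le_rfl (by omega) (by rw [hN])).trans ?_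
            rw [← triSitePercolation_real_triVCross (σ s) a2 0 u N, hμt']
            exact measureReal_mono (hfullU a2 u F (by omega) (by omega) hBF hHF) (measure_ne_top _ _)
          have h3 : q ≤ μ'.real (Ucol Col₃ F) := by
            refine (hqu' (w := N) (h := u) le_rfl (by omega) (by rw [hN])).trans ?_
            rw [← triSitePercolation_real_triVCross (σ s) a3 0 u N, hμt']
            exact measureReal_mono (hfullU a3 u F (by omega) (by omega) hBF hHF) (measure_ne_top _ _)
          have h4 : q ≤ μ'.real USL := by
            refine (hqu' (w := bS4) (h := wS) (by omega) (by omega) (by omega)).trans (le_of_eq ?_)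
            rw [hUSL, ← hμt', triSitePercolation_real_triHCross]
          have h5 : q ≤ μ'.real USR := by
            refine (hqu' (w := 4 * u) (h := wS) (by omega) (by omega) (by omega)).trans (le_of_eq ?_)
            rw [hUSR, ← hμt', triSitePercolation_real_triHCross, hMaS]
          have s1 := harris (σ s) (hd₂ F) (hd₃ F) (hupU _ F) (hupU _ F) hq0 hq0 h2 h3
          have s2 := harris (σ s) ((hd₂ F).mono (Finset.coe_subset.2 Finset.subset_union_left) |>.inter
            ((hd₃ F).mono (Finset.coe_subset.2 Finset.subset_union_right))) hdSL
            ((hupU _ F).inter (hupU _ F)) (isUpperSet_triHCross _ _ _ _) (mul_nonneg hq0 hq0) hq0 s1 h4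
          have s3 := harris (σ s) ((((hd₂ F).mono (Finset.coe_subset.2 Finset.subset_union_left) |>.inter
            ((hd₃ F).mono (Finset.coe_subset.2 Finset.subset_union_right))).mono
              (Finset.coe_subset.2 Finset.subset_union_left)).inter
              (hdSL.mono (Finset.coe_subset.2 Finset.subset_union_right))) hdSR
            (((hupU _ F).inter (hupU _ F)).inter (isUpperSet_triHCross _ _ _ _)) (isUpperSet_triHCross _ _ _ _)
            (mul_nonneg (mul_nonneg hq0 hq0) hq0) hq0 s2 h5
          calc q ^ 4 = q * q * q * q := by ring
            _ ≤ _ := s3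
        -- the open group, priced at `s`
        have hOG5 : q ^ 5 ≤ μ.real (OG F) := by
          have h1 : q ≤ μ.real (Ucol Col₁ F) := by
            refine (hqu (w := N) (h := wS) (by omega) (by omega) (by rw [hN]; omega)).trans ?_
            rw [← triSitePercolation_real_triVCross s a1 0 wS N, hμt]
            exact measureReal_mono (hfullU a1 wS F (by omega) (by omega) hBF hHF) (measure_ne_top _ _)
          have h2 : q ≤ μ.real UHL := by
            refine (hqu (w := WW + wS) (h := hT4) (by omega) (by omega) (by omega)).trans (le_of_eq ?_)
            rw [hUHL, ← hμt, triSitePercolation_real_triHCross]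
          have h3 : q ≤ μ.real (Uv VBL F) := by
            refine (hqu (w := hV9) (h := wS) (by omega) (by omega) (by omega)).trans ?_
            rw [← triSitePercolation_real_triVCross s 0 BV wS hV9, hμt]
            exact measureReal_mono (hfullVL F η hg) (measure_ne_top _ _)
          have h4 : q ≤ μ.real UHR := by
            refine (hqu (w := wS + WW) (h := hT4) (by omega) (by omega) (by omega)).trans (le_of_eq ?_)
            rw [hUHR, ← hμt, triSitePercolation_real_triHCross]
          have h5 : q ≤ μ.real (Uv VBR F) := by
            refine (hqu (w := hV9) (h := wS) (by omega) (by omega) (by omega)).trans ?_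
            rw [← triSitePercolation_real_triVCross s ((M : ℤ) - wS) BV wS hV9, hμt]
            exact measureReal_mono (hfullVR F η hg) (measure_ne_top _ _)
          have dA := hd₁ F
          have dB := hdHL
          have dAB := (dA.mono (Finset.coe_subset.2 Finset.subset_union_left)).inter
            (dB.mono (Finset.coe_subset.2 (Finset.subset_union_right (s₁ := Col₁f \ F))))
          have dABC := (dAB.mono (Finset.coe_subset.2 Finset.subset_union_left)).inter
            ((hdVL F).mono (Finset.coe_subset.2 (Finset.subset_union_right (s₁ := Col₁f \ F ∪ HLf))))
          have dABCD := (dABC.mono (Finset.coe_subset.2 Finset.subset_union_left)).inter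
            (hdHR.mono (Finset.coe_subset.2 (Finset.subset_union_right (s₁ := Col₁f \ F ∪ HLf ∪ VBLf \ F))))
          have uA := hupU Col₁ F
          have uAB := uA.inter (isUpperSet_triHCross (-(WW : ℤ)) ((Hh : ℤ) + 1) (WW + wS) hT4)
          have uABC := uAB.inter (hupUv VBL F)
          have uABCD := uABC.inter (isUpperSet_triHCross ((M : ℤ) - wS) ((Hh : ℤ) + 1) (wS + WW) hT4)
          have s1 := harris s dA dB uA (isUpperSet_triHCross _ _ _ _) hq0 hq0 h1 h2
          have s2 := harris s dAB (hdVL F) uAB (hupUv VBL F) (mul_nonneg hq0 hq0) hq0 s1 h3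
          have s3 := harris s dABC hdHR uABC (isUpperSet_triHCross _ _ _ _)
            (mul_nonneg (mul_nonneg hq0 hq0) hq0) hq0 s2 h4
          have s4 := harris s dABCD (hdVR F) uABCD (hupUv VBR F)
            (mul_nonneg (mul_nonneg (mul_nonneg hq0 hq0) hq0) hq0) hq0 s3 h5
          calc q ^ 5 = q * q * q * q * q := by ring
            _ ≤ _ := s4
        calc q ^ 9 = q ^ 4 * q ^ 5 := by ring
          _ ≤ _ := mul_le_mul hCG4 hOG5 (by positivity) (hnn s _)
      · simp
  /- the good data contain an independent pair of crossing events -/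
  set E₂ : Set (Set (Site 2)) := triHCross 0 (((25 * u : ℕ) : ℤ) + 1) M (4 * u) with hE₂
  set F₀ : Set (Set (Site 2)) := {ω | ωᶜ ∈ triHCross 0 B0 M u} ∩ {ω | ωᶜ ∈ triVCross a1 0 wS (25 * u)} with hF₀
  have hsubgood : E₂ ∩ F₀ ⊆ {ω | ω ∈ Aev (explored M N ω) ((explored M N ω).filter (· ∈ ω))} := by
    rintro ω ⟨hE, hH0, hV0⟩
    have hg : good (explored M N ω) ((explored M N ω).filter (· ∈ ω)) := by
      refine ⟨bottomSide_subset_explored ω, fun e he => ?_, ?_, ?_⟩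
      · have := explored_row_le (h := 25 * u) (h₂ := 4 * u) hE he; push_cast at this; omega
      · have hLR : LRPathIn M N ω := by
          obtain ⟨x, y, hx, hy, hp⟩ := hE
          refine ⟨x, y, hx, by rw [hy]; ring, hp.mono ?_⟩
          rintro z ⟨hz1, hz⟩
          rw [mem_triStrip] at hz1
          exact ⟨Finset.mem_coe.2 (mem_rectangle_iff.2 ⟨hz1.1, by omega, by omega, by omega⟩), hz⟩
        refine (exists_lr_subset_explored hLR).mono ?_
        rintro z ⟨-, hzω, hzE⟩
        exact ⟨hzE, Finset.mem_coe.2 (Finset.mem_filter.2 ⟨Finset.mem_coe.1 hzE, hzω⟩)⟩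
      · obtain ⟨⟨x, y, hx, hy, hp⟩, ⟨b, d, hb, hd, hp'⟩⟩ :=
          floor_subset_explored (M := M) (N := N) (B₀ := B0) (h := u) (a₀ := a1) (w := wS) (k := 25 * u)
            (by omega) (by omega) (by omega) (by omega) (by push_cast; omega) hH0 hV0
        have incl : (↑(explored M N ω) : Set (Site 2)) \ ω ⊆
            ↑(explored M N ω) \ ↑((explored M N ω).filter (· ∈ ω)) := fun z hz =>
          ⟨hz.1, fun hzη => hz.2 (Finset.mem_filter.1 (Finset.mem_coe.1 hzη)).2⟩
        exact ⟨⟨x, y, hx, hy, hp.mono (inter_subset_inter_right _ incl)⟩,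
          ⟨b, d, hb, hd, hp'.mono (inter_subset_inter_right _ incl)⟩⟩
    show ω ∈ Aev (explored M N ω) ((explored M N ω).filter (· ∈ ω))
    simp only [hAev, hg, if_true, mem_univ]
  have hE₂F₀ : μ.real (E₂ ∩ F₀) = μ.real E₂ * μ.real F₀ := by
    refine sitePercolation_real_inter_of_disjoint s (F := triStripFinset 0 (((25 * u : ℕ) : ℤ) + 1) M (4 * u))
      (G := triStripFinset 0 B0 M u ∪ triStripFinset a1 0 wS (25 * u)) (determinedBy_triHCross _ _ _ _)
      (((determinedBy_compl_mem (determinedBy_triHCross 0 B0 M u)).mono ?_).inter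
        ((determinedBy_compl_mem (determinedBy_triVCross a1 0 wS (25 * u))).mono ?_)) ?_
    · rw [Finset.coe_union]; exact subset_union_left
    · rw [Finset.coe_union]; exact subset_union_right
    · rw [Finset.disjoint_left]
      intro z hz hz'
      have h1 := mem_triStrip.1 (by rw [hcoe]; exact Finset.mem_coe.2 hz)
      rcases Finset.mem_union.1 hz' with hz' | hz' <;>
        · have h2 := mem_triStrip.1 (by rw [hcoe]; exact Finset.mem_coe.2 hz'); push_cast at h1 h2; omega
  have hE₂val : q ≤ μ.real E₂ := by
    refine (hqu (w := M) (h := 4 * u) (by omega) (by omega) (by omega)).trans (le_of_eq ?_)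
    rw [hE₂, ← hμt, triSitePercolation_real_triHCross]
  have hF₀val : q * q ≤ μ.real F₀ := by
    have e : μ.real F₀ = μ'.real (triHCross 0 B0 M u ∩ triVCross a1 0 wS (25 * u)) := by
      rw [hμ, hμ', ← sitePercolation_real_preimage_compl]; rfl
    rw [e]
    refine harris (σ s) (determinedBy_triHCross 0 B0 M u) (determinedBy_triVCross a1 0 wS (25 * u))
      (isUpperSet_triHCross 0 B0 M u) (isUpperSet_triVCross a1 0 wS (25 * u)) hq0 hq0 ?_ ?_
    · exact (hqu' (w := M) (h := u) le_rfl (by omega) (by omega)).trans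
        (le_of_eq (triSitePercolation_real_triHCross (σ s) 0 B0 M u).symm)
    · exact (hqu' (w := 25 * u) (h := wS) (by omega) (by omega) (by omega)).trans
        (le_of_eq (triSitePercolation_real_triVCross (σ s) a1 0 wS (25 * u)).symm)
  /- the event of the right-hand side implies the five arms -/
  have hsubarm : {ω | ω ∈ Bev (explored M N ω) ((explored M N ω).filter (· ∈ ω))} ⊆
      {ω | ∃ v ∈ explored M N ω, ∀ (z : Site 2) (r R : ℕ), triNorm (v - z) ≤ r → r + 1 < R → R + r ≤ D →
        SiteConfig.relabel (triShiftIso (-z)).toEquiv ω ∈ altFourArm (r + 1) R □ armEvent ![true] (r + 1) R} := by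
    intro ω hω
    change ω ∈ Bev (explored M N ω) ((explored M N ω).filter (· ∈ ω)) at hω
    simp only [hBev] at hω
    split_ifs at hω with hg
    · obtain ⟨hCGm, ⟨⟨⟨⟨t₁, ht₁, g₁, e₁, he₁, hge₁, hp₁⟩, ⟨xH, yH, hxH, hyH, hpH⟩⟩, hVLm⟩,
        ⟨xK, yK, hxK, hyK, hpK⟩⟩, hVRm⟩ := hω
      obtain ⟨⟨⟨⟨t₂, ht₂, g₂, e₂, he₂, hge₂, hp₂⟩, ⟨t₃, ht₃, g₃, e₃, he₃, hge₃, hp₃⟩⟩,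
        ⟨xβ, yβ, hxβ, hyβ, hβ⟩⟩, ⟨xγ, yγ, hxγ, hyγ, hγ⟩⟩ := hCGm
      obtain ⟨hBF, hHF, hLRo, hfloor⟩ := hg
      have hColR : ∀ (a : ℤ) (w : ℕ), 0 ≤ a → a + w ≤ M → ∀ z ∈ triStrip a 0 w N, z ∈ (↑(rectangle M N) : Set (Site 2)) :=
        fun a w ha haM z hz => by
          rw [mem_triStrip] at hz
          exact Finset.mem_coe.2 (mem_rectangle_iff.2 ⟨by omega, by omega, hz.2.2.1, by omega⟩)
      have hg₁ := mem_triStrip.1 hp₁.right_mem.1.1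
      refine exists_forall_relabel_shift_mem_alt_disjointOccurrence (M := M) (N := N) (ω := ω) (WL := WW) (WR := WW)
        (wL := wS) (wR := wS) (hT := hT4) (hs := wS) (hV := hV9) (bS := bS4) (a₁ := a1) (b₁ := a1 + wS)
        (a₂ := a2) (b₂ := a2 + u) (a₃ := a3) (b₃ := a3 + u) (aS := aS) (BV := BV) (B₀ := B0) (H := Hh) (D := D)
        (by omega) (by omega) (by omega) (by omega) (by omega) (by omega) (by omega) (by omega)
        (by omega) (by omega) (by omega) (by omega) (by omega) (by omega) (by omega) (by omega) (by omega)
        ?_ hHF ?_ ?_ ?_ ?_ ?_ ?_ ?_ ?_ ?_ ?_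
      · exact hLRo.mono fun z hz => (Finset.mem_filter.1 (Finset.mem_coe.1 hz.2.2)).2
      · -- the floor
        intro S x y hS hx hy hP hconn
        refine floor_rows_ge (M := M) (N := N) (C := ↑(explored M N ω) \ ↑((explored M N ω).filter (· ∈ ω)))
          (B₀ := B0) (B₁ := B0 + u) (a₀ := a1) (a₁ := a1 + wS) (by omega) (by omega) (by omega) (by omega)
          hfloor.1 hfloor.2 ?_ (fun z hz => (hS hz).1) hx hy hP hconn
        rw [Set.disjoint_left]
        intro z hz hz'
        exact hz'.2 (Finset.mem_coe.2 (Finset.mem_filter.2 ⟨Finset.mem_coe.1 hz'.1, (hS hz).2⟩))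
      · exact ⟨t₁, ht₁, g₁, e₁, he₁, hge₁, ⟨hg₁.1, hg₁.2.1⟩,
          hp₁.mono fun z hz => ⟨⟨hColR a1 wS (by omega) (by omega) z hz.1.1, hz.1.2⟩, hz.2⟩⟩
      · refine ⟨t₂, ht₂, g₂, e₂, he₂, hge₂, hp₂.mono fun z hz => ⟨⟨hColR a2 u (by omega) (by omega) z hz.1.1, hz.1.2⟩, ?_, hz.2⟩⟩
        have := mem_triStrip.1 hz.1.1; exact ⟨this.1, this.2.1⟩
      · refine ⟨t₃, ht₃, g₃, e₃, he₃, hge₃, hp₃.mono fun z hz => ⟨⟨hColR a3 u (by omega) (by omega) z hz.1.1, hz.1.2⟩, ?_, hz.2⟩⟩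
        have := mem_triStrip.1 hz.1.1; exact ⟨this.1, this.2.1⟩
      · exact ⟨xβ, yβ, hxβ, by rw [hyβ]; ring, hβ⟩
      · exact ⟨xγ, yγ, hxγ, by rw [hyγ, hMaS]; push_cast; omega, hγ⟩
      · exact ⟨xH, yH, hxH, by rw [hyH]; push_cast; omega, hpH⟩
      · exact hVLm
      · exact ⟨xK, yK, hxK, by rw [hyK]; push_cast; ring, hpK⟩
      · exact hVRm
    · simp at hω
  /- assembly -/
  have h9 : 0 ≤ q ^ 9 := by positivity
  calc q ^ 12 = q * (q * q) * q ^ 9 := by ring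
    _ ≤ μ.real E₂ * μ.real F₀ * q ^ 9 :=
        mul_le_mul_of_nonneg_right (mul_le_mul hE₂val hF₀val (mul_nonneg hq0 hq0) (hnn s _)) h9
    _ = q ^ 9 * μ.real (E₂ ∩ F₀) := by rw [hE₂F₀]; ring
    _ ≤ q ^ 9 * μ.real {ω | ω ∈ Aev (explored M N ω) ((explored M N ω).filter (· ∈ ω))} :=
        mul_le_mul_of_nonneg_left (measureReal_mono hsubgood (measure_ne_top _ _)) h9
    _ ≤ μ.real {ω | ω ∈ Bev (explored M N ω) ((explored M N ω).filter (· ∈ ω))} := hdec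
    _ ≤ _ := by rw [hμt]; exact measureReal_mono hsubarm (measure_ne_top _ _)

end Literature.Probability.Percolation
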